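import Summits.Ventures.CertifiedArithmetic.LowPrec.SRLimitedBitsMSE
import Summits.Ventures.CertifiedArithmetic.LowPrec.SRCertificatesFP6FP8
import HarnessLib

/-!
# Stochastic rounding in low-precision formats XCII — the Pythagorean MSE law beyond equally spaced
# windows: DRIFT-ANTITONE outcome trees satisfy `E(ŝₙ − sₙ)² ≤ n·G²/4 + (n·ε·G)²`; across a binade
# boundary `SR_ε`, P3109 StochasticB and an admissible non-monotone rule BREAK it (kernel-checked)

HONEST FRAMING: certified error envelopes and provably optimal rounding/accumulation schemes for
low-precision formats under stated cost models; every table by two implementations; no hardware or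
vendor claims.

Setting (files XIX `SRLimitedBits`, LX `SRLimitedBitsMSE`): recursive summation `ŝ₀ = s`,
`ŝₖ₊₁ = round(ŝₖ + xₖ)` into a finite value set `F`, each step rounding AWAY from zero with probability
`q(θ)` (`θ` the exact-SR away-probability, `q : [0,1] → [0,1]`, `|q − id| ≤ ε`: P3109 StochasticA/B/C,
`SR_ε` of [XiaEtAl2022], exact SR).  File LX proved the PYTHAGOREAN law (exact-SR variance budget plus
worst-case bias SQUARED, no cross term) `E(ŝₙ − sₙ)² ≤ n·g²/4 + (n·ε·g)²` on an EQUALLY SPACED one-signed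
window (`UniformWindow`, spacing `g`) and left the law with `G` = the largest gap met across a binade
boundary open ("NOT claimed"; gen12 enumeration: no violation, closest approach `41/42`).  Settled here:
1. `LimitedBits.accExpQ_sq_le_of_driftAntitone` (any `F`, window, sign pattern): no branch saturates,
   every candidate gap met is `≤ G`, and the outcome tree is DRIFT-ANTITONE (`DriftAntitone`, decidable
   via `driftAntitoneB_iff`: at every branch point the expected remaining drift `E[ŝₙ | ŝₖ₊₁ = t] − t`
   from the upper candidate is `≤` that from the lower one) ⟹ `E(ŝₙ − sₙ)² ≤ n·G²/4 + (n·ε·G)²`.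
   Mechanism: splitting the square at a branch point `c`, the one term not covered by the budget is the
   noise–bias cross term `2·π·(⌈c⌉ − c)·Δ`, `Δ = drift-to-go(⌈c⌉) − drift-to-go(⌊c⌋)`, signed like `Δ`.
2. `LimitedBits.UniformWindow.driftAntitone`: on an equally spaced one-signed window `Δ ≡ 0`
   (translation conjugacy, file LX), so LX's theorem is the corollary `accExpQ_sq_le_uniform'`.
3. WHERE IT BREAKS — one-signed windows meeting TWO spacings (a binade boundary), `G` = the larger gap,
   all hypotheses of item 1 except drift-antitonicity certified by `decide +kernel`:
   * `Formats.e3m2_pyth_fails_nonmonotone`: E3M2, the ADMISSIBLE rule `qSwap` (`|q − id| ≤ 1/4`,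
     `q(1/4) = 1/2`, `q(1/2) = 1/4`: non-monotone), `6 + 5/2 + 1/2 − 3/2`, window `[6, 12]` (spacing 1
     below 8, 2 above): `E(ŝ₃ − 15/2)² = 43/8 > 21/4 = 3·2²/4 + (3·¼·2)²` — THREE additions suffice in
     the admissible class (the monotone `SR_{1/4}` gives `41/8` there: the gen12 `41/42`);
   * `Formats.e3m2_pyth_fails_stochasticB1`: E3M2, IEEE P3109 StochasticB with ONE random bit
     (`ε = 1/4`, monotone), `6 + 5/2 + 1/2 + 1/2 − 3/2`, window `[6, 14]`: `E(ŝ₄ − 8)² = 129/16 > 8`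
     (after three additions `= 21/4 =` the bound: attained, then exceeded);
   * `Formats.e2m3_pyth_fails_srEps`: E2M3, `SR_ε` of [XiaEtAl2022] with `ε = 1/4`,
     `7/2 + 5/8 + 1/8 + 1/8 + 1/8 + 1/8 − 3/8`, window `[7/2, 13/2]` (spacing 1/4 below 4, 1/2 above):
     `E(ŝ₆ − 17/4)² = 1921/2048 > 15/16 = 1920/2048`.
   Each violating tree is (item 1) not drift-antitone (`…_not_driftAntitone`); neither window is
   equally spaced (`e3m2_window_6_14_not_uniform`, `e2m3_window_not_uniform`).
4. Item 1 certifies binade- and zero-crossing instances OUTSIDE file LX by a kernel check of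
   `DriftAntitone`: StochasticA (1, 2 bits) and exact SR on the StochasticB witness data
   (`Formats.e3m2_binade_driftAntitone`, `e3m2_binade_certified`), StochasticA across zero on the LX
   cross-zero data (`FP4.e2m1_cross_zero_stochasticA_driftAntitone`; `SR_{1/8}` violates there, LX).
EVIDENCE ONLY (sr seat certificates gen16/pyth, two implementations; 1 848 737 instances, E3M2/E2M3,
`n ≤ 6`, eleven rules): across a binade boundary the law is violated by `qSwap` from `n = 3`, by
StochasticB (1 bit) from `n = 4`, by `SR_{1/4}` from `n = 6` (650 violations, none drift-antitone, none
for `n ≤ 2`, largest excess `43/42`, monotone `129/128`); the toward-zero-biased rules (`θ − ε ≤ q ≤ θ`: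
StochasticA 1–3 bits, exact SR, `SR_{−1/4}`) and also StochasticB 2 bits, StochasticC 1 bit, `SR_{1/8}`
produced none there (though their trees are not always drift-antitone); across zero only `SR_ε`
violates.  The triangle law `(√n·G/2 + n·ε·G)²` of file LXI is a theorem on every window.
Prior art: [ElararEtAl2025, Thm. 3–4] (first-order probabilistic bound `√n·u_p + n·u_{p+r}` for
`SR_{p,r}`); [XiaEtAl2022] (`SR_ε`); IEEE P3109 StochasticA/B/C (`Literature/…/P3109`).  Here: the
exact second-moment law's domain of validity — a checkable sufficient condition and kernel-checked
counterexamples at the first binade boundary.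
-/

namespace Summit.Ventures.CertifiedArithmetic.LowPrec.SR

open Literature.ComputerArithmetic.ConnollyHighamMary2021
open Finset

variable {K : Type*} [Field K] [LinearOrder K] [IsStrictOrderedRing K]

namespace LimitedBits

/-! ### The drift-antitone tree predicate -/

/-- `DriftAntitone F q x n s`: at every branch point `c = ŝₖ + xₖ` of the outcome tree (candidates
`⌈c̄⌉ ≥ ⌊c̄⌋`), the expected remaining drift from the upper candidate is at most that from the lower
one: `E[ŝₙ | ŝₖ₊₁ = ⌈c̄⌉] − ⌈c̄⌉ ≤ E[ŝₙ | ŝₖ₊₁ = ⌊c̄⌋] − ⌊c̄⌋`. -/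
def DriftAntitone (F : Finset K) (q : K → K) : (ℕ → K) → ℕ → K → Prop
  | _, 0, _ => True
  | x, n + 1, s =>
      (accExpQ F q (fun i => x (i + 1)) n (fun y => y) (up F (s + x 0)) - up F (s + x 0)
          ≤ accExpQ F q (fun i => x (i + 1)) n (fun y => y) (dn F (s + x 0)) - dn F (s + x 0))
      ∧ DriftAntitone F q (fun i => x (i + 1)) n (up F (s + x 0))
      ∧ DriftAntitone F q (fun i => x (i + 1)) n (dn F (s + x 0))

/-- Boolean evaluator of `DriftAntitone` (clean kernel reduction for `decide` certificates). -/
def driftAntitoneB (F : Finset K) (q : K → K) : (ℕ → K) → ℕ → K → Bool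
  | _, 0, _ => true
  | x, n + 1, s =>
      decide (accExpQ F q (fun i => x (i + 1)) n (fun y => y) (up F (s + x 0)) - up F (s + x 0)
          ≤ accExpQ F q (fun i => x (i + 1)) n (fun y => y) (dn F (s + x 0)) - dn F (s + x 0))
      && driftAntitoneB F q (fun i => x (i + 1)) n (up F (s + x 0))
      && driftAntitoneB F q (fun i => x (i + 1)) n (dn F (s + x 0))

omit [IsStrictOrderedRing K] in
/-- `driftAntitoneB` computes `DriftAntitone`. -/
theorem driftAntitoneB_iff (F : Finset K) (q : K → K) (x : ℕ → K) (n : ℕ) (s : K) :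
    driftAntitoneB F q x n s = true ↔ DriftAntitone F q x n s := by
  induction n generalizing x s with
  | zero => simp [driftAntitoneB, DriftAntitone]
  | succ n ih => simp [driftAntitoneB, DriftAntitone, ih, Bool.and_eq_true, and_assoc]

/-- `DriftAntitone` is decidable (via `driftAntitoneB`). -/
instance instDecidableDriftAntitone (F : Finset K) (q : K → K) (x : ℕ → K) (n : ℕ) (s : K) :
    Decidable (DriftAntitone F q x n s) :=
  decidable_of_iff _ (driftAntitoneB_iff F q x n s)

/-! ### Drift-antitone trees satisfy the Pythagorean law -/

set_option maxHeartbeats 800000 in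
/-- **MSE of recursive summation under limited-randomness SR, drift-antitone trees**: if
`q : [0,1] → [0,1]`, `|q − id| ≤ ε`, no branch saturates, every candidate gap met is `≤ G` and the
outcome tree is drift-antitone, then `E(ŝₙ − (s + ∑ xₖ))² ≤ n·G²/4 + (n·ε·G)²` — on ANY finite value
set, any window, any sign pattern.  At a branch point `c` with candidates `u ≥ d`, up-probability `π`,
drift-to-go `Φ(u) = Φ(d) + Δ`:  `E(ŝ − (c+S))² = [π·M(u) + (1−π)·M(d)] + 2·Φ(d)·(E round(c) − c)
+ 2·π·(u − c)·Δ + E(round(c) − c)²`, and `Δ ≤ 0` kills the only term not covered by the budget. -/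
theorem accExpQ_sq_le_of_driftAntitone (F : Finset K) {q : K → K} {ε G : K}
    (hq01 : ∀ η, 0 ≤ η → η ≤ 1 → 0 ≤ q η ∧ q η ≤ 1) (hq : ∀ η, 0 ≤ η → η ≤ 1 → |q η - η| ≤ ε) :
    ∀ (x : ℕ → K) (n : ℕ) (s : K), NoSat F x n s → GapLE F G x n s → DriftAntitone F q x n s →
      accExpQ F q x n (fun t => (t - (s + ∑ i ∈ range n, x i)) ^ 2) s
        ≤ n * (G ^ 2 / 4) + (n * (ε * G)) ^ 2 := by
  have hε : 0 ≤ ε := (abs_nonneg _).trans (hq 0 le_rfl zero_le_one)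
  intro x n
  induction n generalizing x with
  | zero => intro s _ _ _; simp [accExpQ]
  | succ n ih =>
    rintro s ⟨hin, hnu, hnd⟩ ⟨hg0, hgu, hgd⟩ ⟨hΔ, hau, had⟩
    have hsum : s + ∑ i ∈ range (n + 1), x i = (s + x 0) + ∑ i ∈ range n, x (i + 1) := by
      rw [Finset.sum_range_succ']; ring
    simp only [hsum]
    show stepQ F q (s + x 0) (accExpQ F q (fun i => x (i + 1)) n
      (fun t => (t - ((s + x 0) + ∑ i ∈ range n, x (i + 1))) ^ 2)) ≤ _
    have hcl : clamp F (s + x 0) = s + x 0 := clamp_eq_self hin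
    have hγ : up F (s + x 0) - dn F (s + x 0) ≤ G := hg0
    have hγ0 : 0 ≤ up F (s + x 0) - dn F (s + x 0) := sub_nonneg.mpr (dn_le_up F _)
    have hG : 0 ≤ G := hγ0.trans hγ
    have hεG : 0 ≤ ε * G := mul_nonneg hε hG
    have hnεG : 0 ≤ (n : K) * (ε * G) := mul_nonneg (Nat.cast_nonneg n) hεG
    have hfin : (n : K) * (G ^ 2 / 4) + (n * (ε * G)) ^ 2 + 2 * ((n * (ε * G)) * (ε * G))
        + G ^ 2 * (1 / 4 + ε ^ 2) = (↑(n + 1) : K) * (G ^ 2 / 4) + (↑(n + 1) * (ε * G)) ^ 2 := by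
      push_cast; ring
    have huc : s + x 0 ≤ up F (s + x 0) := by unfold up; rw [hcl]; exact le_roundUp F _
    set c := s + x 0 with hc
    set x' : ℕ → K := fun i => x (i + 1) with hx'
    set S' : K := ∑ i ∈ range n, x' i with hS'
    have hMu := ih x' (up F c) hnu hgu hau
    have hMd := ih x' (dn F c) hnd hgd had
    have hBd : |accExpQ F q x' n (fun t => t) (dn F c) - (dn F c + S')| ≤ n * (ε * G) :=
      abs_accExpQ_id_sub_le F hq01 hq x' n (dn F c) hnd hgd
    obtain ⟨hp0, hp1⟩ := pUpQ_mem F hq01 c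
    have hβ : |stepQ F q c (fun t => t) - clamp F c| ≤ ε * G :=
      (abs_stepQ_id_sub_le F hq c).trans (mul_le_mul_of_nonneg_left hγ hε)
    rw [hcl] at hβ
    have hE2 : stepQ F q c (fun z => (z - c) ^ 2) ≤ G ^ 2 * (1 / 4 + ε ^ 2) :=
      (stepQ_sq_le F hq hin).trans (mul_le_mul_of_nonneg_right (pow_le_pow_left₀ hγ0 hγ 2)
        (by positivity))
    simp only [stepQ] at hβ hE2 ⊢
    rw [accExpQ_sq_split F q x' n (up F c) S' c, accExpQ_sq_split F q x' n (dn F c) S' c]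
    have hΔ' : accExpQ F q x' n (fun t => t) (up F c) - (up F c + S')
        ≤ accExpQ F q x' n (fun t => t) (dn F c) - (dn F c + S') := by linarith [hΔ]
    set π := pUpQ F q c
    set u := up F c
    set d := dn F c
    set bu := accExpQ F q x' n (fun t => t) u - (u + S')
    set b := accExpQ F q x' n (fun t => t) d - (d + S')
    set Mu := accExpQ F q x' n (fun y => (y - (u + S')) ^ 2) u
    set Md := accExpQ F q x' n (fun y => (y - (d + S')) ^ 2) d
    clear_value π u d bu b Mu Md c x' S'
    have hT1 : π * Mu + (1 - π) * Md ≤ n * (G ^ 2 / 4) + (n * (ε * G)) ^ 2 := by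
      have a1 := mul_le_mul_of_nonneg_left hMu hp0
      have a2 := mul_le_mul_of_nonneg_left hMd (sub_nonneg.mpr hp1)
      linarith
    have hT2 : b * (π * u + (1 - π) * d - c) ≤ (n * (ε * G)) * (ε * G) :=
      calc b * (π * u + (1 - π) * d - c) ≤ |b * (π * u + (1 - π) * d - c)| := le_abs_self _
        _ = |b| * |π * u + (1 - π) * d - c| := abs_mul _ _
        _ ≤ (n * (ε * G)) * (ε * G) := mul_le_mul hBd hβ (abs_nonneg _) hnεG
    have hT3 : π * (u - c) * (bu - b) ≤ 0 :=
      mul_nonpos_of_nonneg_of_nonpos (mul_nonneg hp0 (sub_nonneg.mpr huc)) (sub_nonpos.mpr hΔ')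
    have hexp : π * (Mu + 2 * (u - c) * bu + (u - c) ^ 2) + (1 - π) * (Md + 2 * (d - c) * b + (d - c) ^ 2)
        = (π * Mu + (1 - π) * Md) + 2 * (b * (π * u + (1 - π) * d - c)) + 2 * (π * (u - c) * (bu - b))
          + (π * (u - c) ^ 2 + (1 - π) * (d - c) ^ 2) := by ring
    rw [hexp]; linarith [hT1, hT2, hT3, hE2, hfin]

/-- On an equally spaced one-signed window the drift-to-go is the same from both candidates at every
branch point (translation conjugacy, file LX), so the tree is drift-antitone. -/
theorem UniformWindow.driftAntitone {F : Finset K} {lo hi g : K} (hU : UniformWindow F lo hi g)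
    (hlo : 0 ≤ lo) (q : K → K) :
    ∀ (x : ℕ → K) (n : ℕ) (s : K), NoSat F x n s → InWindow F lo hi x n s → DriftAntitone F q x n s := by
  intro x n
  induction n generalizing x with
  | zero => intro s _ _; trivial
  | succ n ih =>
    rintro s ⟨hin, hnu, hnd⟩ ⟨⟨h1, h2⟩, hwu, hwd⟩
    refine ⟨?_, ih _ _ hnu hwu, ih _ _ hnd hwd⟩
    have hcl : clamp F (s + x 0) = s + x 0 := clamp_eq_self hin
    rw [hcl] at h1 h2
    rcases hU.roundUp_eq_or h1 h2 with hw0 | hwg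
    · have hu : up F (s + x 0) = dn F (s + x 0) := by unfold up dn; rw [hcl, hw0]
      rw [hu]
    · have hug : up F (s + x 0) = dn F (s + x 0) + g := by unfold up dn; rw [hcl]; exact hwg
      have hsh := hU.accExpQ_shift hlo q (fun i => x (i + 1)) n (fun t => t) (dn F (s + x 0)) hnd hwd
        (by rw [← hug]; exact hnu) (by rw [← hug]; exact hwu)
      rw [hug, hsh, accExpQ_id_add]
      linarith

/-- File LX's theorem as a COROLLARY of `accExpQ_sq_le_of_driftAntitone`: the equally spaced window
enters only through `Δ = 0` (`UniformWindow.driftAntitone`) and `GapLE g` (`UniformWindow.gapLE`). -/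
theorem accExpQ_sq_le_uniform' (F : Finset K) {q : K → K} {ε lo hi g : K}
    (hq01 : ∀ η, 0 ≤ η → η ≤ 1 → 0 ≤ q η ∧ q η ≤ 1) (hq : ∀ η, 0 ≤ η → η ≤ 1 → |q η - η| ≤ ε)
    (hU : UniformWindow F lo hi g) (hlo : 0 ≤ lo) (x : ℕ → K) (n : ℕ) (s : K) (hns : NoSat F x n s)
    (hw : InWindow F lo hi x n s) :
    accExpQ F q x n (fun t => (t - (s + ∑ i ∈ range n, x i)) ^ 2) s
      ≤ n * (g ^ 2 / 4) + (n * (ε * g)) ^ 2 :=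
  accExpQ_sq_le_of_driftAntitone F hq01 hq x n s hns (hU.gapLE x n s hw) (hU.driftAntitone hlo q x n s hns hw)

end LimitedBits

/-- The summand sequence listed in `l` (then zeros). -/
def seqL (l : List K) : ℕ → K := fun i => l.getD i 0

/-- An ADMISSIBLE but non-monotone rule at `ε = 1/4`: exact SR except `q(1/4) = 1/2`, `q(1/2) = 1/4`. -/
def qSwap (θ : ℚ) : ℚ := if θ = 1 / 4 then 1 / 2 else if θ = 1 / 2 then 1 / 4 else θ

/-- `qSwap` maps `[0,1]` into `[0,1]`. -/
theorem qSwap_mem : ∀ η : ℚ, 0 ≤ η → η ≤ 1 → 0 ≤ qSwap η ∧ qSwap η ≤ 1 := by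
  intro η h0 h1
  unfold qSwap
  split_ifs <;> subst_vars <;> first | exact ⟨h0, h1⟩ | norm_num

/-- `qSwap` is within `1/4` of exact SR. -/
theorem qSwap_dev : ∀ η : ℚ, 0 ≤ η → η ≤ 1 → |qSwap η - η| ≤ 1 / 4 := by
  intro η _ _
  unfold qSwap
  split_ifs <;> subst_vars <;> norm_num

/-- `qSwap` is not monotone. -/
theorem qSwap_not_monotone : ¬ Monotone qSwap := by
  intro h
  have := h (show (1 : ℚ) / 4 ≤ 1 / 2 by norm_num)
  norm_num [qSwap] at this

namespace Formats

open LimitedBits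

/-- Witness summands `5/2, 1/2, −3/2` (three additions from `6`; exact sum `15/2`). -/
def xW3 : ℕ → ℚ := seqL [5 / 2, 1 / 2, -3 / 2]

/-- Witness summands `5/2, 1/2, 1/2, −3/2` (four additions from `6`; exact sum `8`). -/
def xW2 : ℕ → ℚ := seqL [5 / 2, 1 / 2, 1 / 2, -3 / 2]

/-- The one-signed window `[6, 14]` of E3M2 (`6, 7, 8, 10, 12, 14`) is not equally spaced. -/
theorem e3m2_window_6_14_not_uniform (hi : ℚ) (hhi : 10 ≤ hi) : ¬ ∃ g, UniformWindow e3m2 6 hi g := by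
  rintro ⟨g, hU⟩
  have h1 := hU.sep 6 (by decide +kernel) 7 (by decide +kernel) le_rfl (by linarith) (by norm_num)
  have h2 := hU.succ_mem 8 (by decide +kernel) (by norm_num) (by linarith)
  have h3 : ∀ v ∈ e3m2, (8 : ℚ) < v → v ≤ 9 → False := by decide +kernel
  exact h3 _ h2 (by linarith [hU.pos]) (by linarith)

/-- **Failure for an admissible non-monotone rule, three additions** (E3M2, `qSwap`, `ε = 1/4`):
from `6`, summands `5/2, 1/2, −3/2`; no saturation, every pre-rounding value in the one-signed window
`[6, 12]`, every gap `≤ G = 2`; `E(ŝ₃ − 15/2)² = 43/8 > 21/4 = 3·G²/4 + (3·ε·G)²`. -/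
theorem e3m2_pyth_fails_nonmonotone :
    NoSat e3m2 xW3 3 6 ∧ InWindow e3m2 6 12 xW3 3 6 ∧ GapLE e3m2 2 xW3 3 6 ∧
      accExpQ e3m2 qSwap xW3 3 (fun t => (t - 15 / 2) ^ 2) 6 = 43 / 8 ∧
      (3 : ℚ) * (2 ^ 2 / 4) + (3 * (1 / 4 * 2)) ^ 2 = 21 / 4 ∧ (21 : ℚ) / 4 < 43 / 8 := by
  refine ⟨?_, ?_, ?_, by decide +kernel, by norm_num, by norm_num⟩
  · rw [← noSatB_iff]; decide +kernel
  · rw [← inWindowB_iff]; decide +kernel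
  · rw [← gapLEB_iff]; decide +kernel

/-- On the same data the monotone `SR_{1/4}` of [XiaEtAl2022] gives `41/8 ≤ 21/4` (the closest approach
`41/42` of the gen12 enumeration), and exact SR gives `63/32`. -/
theorem e3m2_W3_srEps_and_exact :
    accExpQ e3m2 (qAway (1 / 4)) xW3 3 (fun t => (t - 15 / 2) ^ 2) 6 = 41 / 8 ∧
      accExpQ e3m2 (fun θ => θ) xW3 3 (fun t => (t - 15 / 2) ^ 2) 6 = 63 / 32 := by
  constructor <;> decide +kernel

/-- The `qSwap` tree is not drift-antitone (as item 1 forces). -/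
theorem e3m2_W3_not_driftAntitone : ¬ DriftAntitone e3m2 qSwap xW3 3 6 := by
  rw [← driftAntitoneB_iff]; decide +kernel

/-- **Failure for IEEE P3109 StochasticB with one random bit, four additions** (E3M2, `ε = 1/4`):
from `6`, summands `5/2, 1/2, 1/2, −3/2`; no saturation, one-signed window `[6, 14]`, gaps `≤ G = 2`;
`E(ŝ₄ − 8)² = 129/16 > 8 = 4·G²/4 + (4·2^{-2}·G)²`. -/
theorem e3m2_pyth_fails_stochasticB1 :
    NoSat e3m2 xW2 4 6 ∧ InWindow e3m2 6 14 xW2 4 6 ∧ GapLE e3m2 2 xW2 4 6 ∧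
      accExpQ e3m2 (probAwayB 1) xW2 4 (fun t => (t - 8) ^ 2) 6 = 129 / 16 ∧
      (4 : ℚ) * (2 ^ 2 / 4) + (4 * (1 / 2 ^ (1 + 1) * 2)) ^ 2 = 8 ∧ (8 : ℚ) < 129 / 16 := by
  refine ⟨?_, ?_, ?_, by decide +kernel, by norm_num, by norm_num⟩
  · rw [← noSatB_iff]; decide +kernel
  · rw [← inWindowB_iff]; decide +kernel
  · rw [← gapLEB_iff]; decide +kernel

/-- After THREE additions (`5/2, 1/2, −3/2`) StochasticB with one bit ATTAINS the bound across the
boundary: `E(ŝ₃ − 15/2)² = 21/4 = 3·G²/4 + (3·ε·G)²`; the fourth addition exceeds it. -/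
theorem e3m2_stochasticB1_three_attains :
    accExpQ e3m2 (probAwayB 1) xW3 3 (fun t => (t - 15 / 2) ^ 2) 6 = 21 / 4 := by
  decide +kernel

/-- The StochasticB tree is not drift-antitone. -/
theorem e3m2_W2_not_driftAntitone : ¬ DriftAntitone e3m2 (probAwayB 1) xW2 4 6 := by
  rw [← driftAntitoneB_iff]; decide +kernel

/-- **Positive binade-crossing certificates through item 1** on the same data (`6 + 5/2 + 1/2 + 1/2 −
3/2`, window `[6, 14]` meeting spacings 1 and 2 — outside file LX): the trees of StochasticA with one
and with two random bits and of exact SR ARE drift-antitone. -/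
theorem e3m2_binade_driftAntitone :
    DriftAntitone e3m2 (probAwayA 1) xW2 4 6 ∧ DriftAntitone e3m2 (probAwayA 2) xW2 4 6 ∧
      DriftAntitone e3m2 (fun θ => θ) xW2 4 6 := by
  refine ⟨?_, ?_, ?_⟩ <;> (rw [← driftAntitoneB_iff]; decide +kernel)

/-- Hence (item 1) on this binade-crossing data StochasticA obeys the law: one bit (`ε = 1/2`)
`E(ŝ₄ − s₄)² ≤ 4·2²/4 + (4·½·2)² = 20`, two bits (`ε = 1/4`) `≤ 4 + (4·¼·2)² = 8` — the bound that
StochasticB with one bit (same `ε = 1/4`) violates on the same data (actual values `e3m2_binade_values`). -/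
theorem e3m2_binade_certified :
    accExpQ e3m2 (probAwayA 1) xW2 4 (fun t => (t - (6 + ∑ i ∈ range 4, xW2 i)) ^ 2) 6
        ≤ (4 : ℕ) * ((2 : ℚ) ^ 2 / 4) + (4 * (1 / 2 ^ 1 * 2)) ^ 2 ∧
      accExpQ e3m2 (probAwayA 2) xW2 4 (fun t => (t - (6 + ∑ i ∈ range 4, xW2 i)) ^ 2) 6
        ≤ (4 : ℕ) * ((2 : ℚ) ^ 2 / 4) + (4 * (1 / 2 ^ 2 * 2)) ^ 2 :=
  ⟨accExpQ_sq_le_of_driftAntitone e3m2 (probAwayA_mem 1) (fun η _ _ => abs_probAwayA_sub_le 1 η) xW2 4 6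
      e3m2_pyth_fails_stochasticB1.1 e3m2_pyth_fails_stochasticB1.2.2.1 e3m2_binade_driftAntitone.1,
    accExpQ_sq_le_of_driftAntitone e3m2 (probAwayA_mem 2) (fun η _ _ => abs_probAwayA_sub_le 2 η) xW2 4 6
      e3m2_pyth_fails_stochasticB1.1 e3m2_pyth_fails_stochasticB1.2.2.1 e3m2_binade_driftAntitone.2.1⟩

/-- The actual values on that data: StochasticA one bit `5/2`, two bits `357/128`, exact SR `357/128`,
StochasticC one bit `5/2`. -/
theorem e3m2_binade_values :
    accExpQ e3m2 (probAwayA 1) xW2 4 (fun t => (t - 8) ^ 2) 6 = 5 / 2 ∧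
      accExpQ e3m2 (probAwayA 2) xW2 4 (fun t => (t - 8) ^ 2) 6 = 357 / 128 ∧
      accExpQ e3m2 (fun θ => θ) xW2 4 (fun t => (t - 8) ^ 2) 6 = 357 / 128 ∧
      accExpQ e3m2 (probAwayC 1) xW2 4 (fun t => (t - 8) ^ 2) 6 = 5 / 2 := by
  refine ⟨?_, ?_, ?_, ?_⟩ <;> decide +kernel

/-- Witness summands `5/8, 1/8, 1/8, 1/8, 1/8, −3/8` (six additions from `7/2`; exact sum `17/4`). -/
def xW1 : ℕ → ℚ := seqL [5 / 8, 1 / 8, 1 / 8, 1 / 8, 1 / 8, -3 / 8]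

/-- The one-signed window `[7/2, 13/2]` of E2M3 (spacing `1/4` below `4`, `1/2` above) is not equally
spaced. -/
theorem e2m3_window_not_uniform : ¬ ∃ g, UniformWindow e2m3 (7 / 2) (13 / 2) g := by
  rintro ⟨g, hU⟩
  have h1 := hU.sep (7 / 2) (by decide +kernel) (15 / 4) (by decide +kernel) le_rfl (by norm_num)
    (by norm_num)
  have h2 := hU.succ_mem 4 (by decide +kernel) (by norm_num) (by norm_num)
  have h3 : ∀ v ∈ e2m3, (4 : ℚ) < v → v ≤ 17 / 4 → False := by decide +kernel
  exact h3 _ h2 (by linarith [hU.pos]) (by linarith)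

/-- **Failure for `SR_ε` of [XiaEtAl2022], six additions** (E2M3, `ε = 1/4`): from `7/2`, summands
`5/8, 1/8, 1/8, 1/8, 1/8, −3/8`; no saturation, one-signed window `[7/2, 13/2]`, gaps `≤ G = 1/2`;
`E(ŝ₆ − 17/4)² = 1921/2048 > 15/16 = 6·G²/4 + (6·ε·G)²`. -/
theorem e2m3_pyth_fails_srEps :
    NoSat e2m3 xW1 6 (7 / 2) ∧ InWindow e2m3 (7 / 2) (13 / 2) xW1 6 (7 / 2) ∧
      GapLE e2m3 (1 / 2) xW1 6 (7 / 2) ∧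
      accExpQ e2m3 (qAway (1 / 4)) xW1 6 (fun t => (t - 17 / 4) ^ 2) (7 / 2) = 1921 / 2048 ∧
      (6 : ℚ) * ((1 / 2) ^ 2 / 4) + (6 * (1 / 4 * (1 / 2))) ^ 2 = 15 / 16 ∧
      (15 : ℚ) / 16 < 1921 / 2048 := by
  refine ⟨?_, ?_, ?_, by decide +kernel, by norm_num, by norm_num⟩
  · rw [← noSatB_iff]; decide +kernel
  · rw [← inWindowB_iff]; decide +kernel
  · rw [← gapLEB_iff]; decide +kernel

/-- The `SR_ε` tree is not drift-antitone (by item 1, without evaluating the predicate). -/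
theorem e2m3_W1_not_driftAntitone : ¬ DriftAntitone e2m3 (qAway (1 / 4)) xW1 6 (7 / 2) := by
  intro h
  have hb := accExpQ_sq_le_of_driftAntitone e2m3 (qAway_mem (by norm_num : (0 : ℚ) ≤ 1 / 4))
    (qAway_dev (by norm_num : (0 : ℚ) ≤ 1 / 4)) xW1 6 (7 / 2) e2m3_pyth_fails_srEps.1
    e2m3_pyth_fails_srEps.2.2.1 h
  have hs : (7 : ℚ) / 2 + ∑ i ∈ range 6, xW1 i = 17 / 4 := by decide +kernel
  rw [hs, e2m3_pyth_fails_srEps.2.2.2.1] at hb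
  norm_num at hb

end Formats

namespace FP4

open LimitedBits

/-- **Across zero, through item 1**: on the file-LX cross-zero data (E2M1, `0 − 5/4 + 5/4`, window
`[−3/2, 1/2]` across `0`), where `SR_{1/8}` violates the law (`e2m1_mse_cross_zero`), the trees of
StochasticA with 1, 2, 3 random bits are drift-antitone, so the law holds for them there. -/
theorem e2m1_cross_zero_stochasticA_driftAntitone :
    DriftAntitone e2m1 (probAwayA 1) (seq3 (-5 / 4) (5 / 4) (5 / 4)) 2 0 ∧
      DriftAntitone e2m1 (probAwayA 2) (seq3 (-5 / 4) (5 / 4) (5 / 4)) 2 0 ∧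
      DriftAntitone e2m1 (probAwayA 3) (seq3 (-5 / 4) (5 / 4) (5 / 4)) 2 0 ∧
      ¬ DriftAntitone e2m1 (qAway (1 / 8)) (seq3 (-5 / 4) (5 / 4) (5 / 4)) 2 0 := by
  refine ⟨?_, ?_, ?_, ?_⟩ <;> (rw [← driftAntitoneB_iff]; decide +kernel)

/-- Hence StochasticA with three bits (`ε = 1/8`, the `ε` of the violating `SR_{1/8}`) obeys
`E(ŝ₂ − 0)² ≤ 2·(1/2)²/4 + (2·⅛·½)² = 9/64` across zero; the actual value is `1/8`. -/
theorem e2m1_cross_zero_stochasticA3 :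
    accExpQ e2m1 (probAwayA 3) (seq3 (-5 / 4) (5 / 4) (5 / 4)) 2
        (fun t => (t - (0 + ∑ i ∈ range 2, seq3 (-5 / 4) (5 / 4) (5 / 4) i)) ^ 2) 0
      ≤ (2 : ℕ) * (((1 : ℚ) / 2) ^ 2 / 4) + (2 * (1 / 2 ^ 3 * (1 / 2))) ^ 2 ∧
    accExpQ e2m1 (probAwayA 3) (seq3 (-5 / 4) (5 / 4) (5 / 4)) 2 (fun t => (t - 0) ^ 2) 0 = 1 / 8 :=
  ⟨accExpQ_sq_le_of_driftAntitone e2m1 (probAwayA_mem 3) (fun η _ _ => abs_probAwayA_sub_le 3 η) _ 2 0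
      e2m1_mse_cross_zero.1 (by rw [← gapLEB_iff]; decide +kernel)
      e2m1_cross_zero_stochasticA_driftAntitone.2.2.1, by decide +kernel⟩

end FP4

end Summit.Ventures.CertifiedArithmetic.LowPrec.SR
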